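import Summits.RiemannHypothesis.RiemannHypothesis.Theorems.LiTailLaguerreNonreleased
import HarnessLib

/-!
# RiemannHypothesis / LiTailLaguerre — BC5 rung `stub_rung_silent` of crux K2′ `LiPrimeTailLaguerre`:
# the prime tail above `(5/4)√n` is bounded (RH-FREE)

RH-FREE [rh-li-tail-p1 g0; binder dealt by director-rh g6 17:09:38Z].  Round 7 of the LI column (theory g9, dossier
`HOME/theory/route/r7`, PART K = `Theorems/LiTailLaguerreDefs.lean`, route `Theses/LiTailLaguerre.lean`, crux
`LiPrimeTailLaguerre` = stmt-RiemannHypothesis-19702, DECIDING).  This file proves the crux's plan-only FIRST RUNG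
(birth skeleton `Cruxes.LiPrimeTailLaguerre.Birth.Sig.stub_rung_silent`, signature verbatim; the tribunal's T3 witness):

  `∀ c ≥ 5/4, ∃ N C, ∀ n ≥ N, ∀ T ∈ [c√n, c√n + 1], |liPrimeTail n T| ≤ C log n`,

i.e. the crux restricted to the SILENT regime `c ≥ 5/4 > (log 2)^{−1/2}`, where no prime power is released
(`⌊e^{1/c²}⌋ = 1`).  In fact `|liPrimeTail n T| ≤ (16 + 440 e) π^{−1} Σ_m Λ(m) m^{−3/2}` for every `n ≥ 1` and every
`T ≥ (5/4)√n` (`abs_liPrimeTail_le`): the rung holds with `N = 2` and is `O(1)`, not just `O(log n)`.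

Proof (van der Corput first-derivative test [Titchmarsh 1986, Lemma 4.3], termwise on `Re w = 3/2`).  On the edge
`w = 3/2 + iy` the prime integrand is `L(Λ, w)(2 − k_n(w)) = Σ_m Λ(m) m^{−w}(2 − zⁿ − z⁻ⁿ)`, `z = 1 − 1/w`, absolutely
convergent (`|zⁿ| ≤ 1`, `|z⁻ⁿ| ≤ e` for `y ≥ √n`), so on every finite window `[T, Y]` the integral is the sum of the
term integrals (dominated convergence, as in the PROVED `PrimeEdge.liPrimeEdge_nonresonant` of route `LiPrimeEcho`).
Above the cut `T ≥ (5/4)√n` EVERY `m ≥ 2` is non-released with the uniform gap `g = log 2 − 16/25 > 1/20`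
(`log m − n/T² ≥ log 2 − 16/25`), so prover g5's non-released term estimate `PrimeTail.norm_integral_termIntegrand_le`
(`Theorems/LiTailLaguerreNonreleased.lean`: one integration by parts per piece with the `θ'`-bound integrated, uniform
in `Y`) bounds the `m`-th term integral by `m^{−3/2}(6/log m + 3n/(2T² log² m) + e^{n/T²}(2/g + 3n/(2T² g²)))
≤ m^{−3/2}(16 + 440 e)`.  Hence `‖∫_T^Y L(Λ, w)(2 − k_n(w)) dy‖ ≤ (16 + 440 e) Σ_m Λ(m) m^{−3/2}` for all `Y ≥ T`,
and `Y → ∞` (`TailContour.tendsto_pieces`, eng g5) gives the bound for `liPrimeTail`.  Nothing here bears on the truth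
of RH; no zeros, no data, no kit.
-/

noncomputable section

-- D-0017: `Summit.<S>.<S>.…` is the designed namespace of a single-problem summit.
set_option linter.dupNamespace false

open Complex MeasureTheory intervalIntegral Set Filter
open scoped Real Interval Topology ArithmeticFunction.vonMangoldt

namespace Summit.RiemannHypothesis.RiemannHypothesis.Theorems.LiTheory

namespace RungSilent

open PrimeEdge TailContour PrimeTail

/-! ### The cut `T ≥ (5/4)√n`: every prime power is non-released with gap `log 2 − 16/25` -/

/-- `log 2 − 16/25 > 1/20`: the phase gap of the `z⁻ⁿ` terms above `(5/4)√n`. -/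
theorem log_two_sub_gt : (1 / 20 : ℝ) < Real.log 2 - 16 / 25 := by
  have := Real.log_two_gt_d9; norm_num at this ⊢; linarith

/-- Cut facts: for `n ≥ 1` and `(5/4)√n ≤ T`: `1 ≤ T`, `√n ≤ T` and `n ≤ (16/25) T²`. -/
theorem cut_facts {n : ℕ} {T : ℝ} (hn : 1 ≤ n) (hT : 5 / 4 * Real.sqrt n ≤ T) :
    1 ≤ T ∧ Real.sqrt n ≤ T ∧ (n : ℝ) ≤ 16 / 25 * T ^ 2 := by
  have hn' : (1 : ℝ) ≤ n := by exact_mod_cast hn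
  have hs1 : 1 ≤ Real.sqrt n := by rw [← Real.sqrt_one]; exact Real.sqrt_le_sqrt hn'
  have hs0 : 0 ≤ Real.sqrt n := Real.sqrt_nonneg _
  have hsq : Real.sqrt n ^ 2 = n := Real.sq_sqrt (by positivity)
  refine ⟨by linarith, by linarith, ?_⟩
  have h1 : 0 ≤ T - 5 / 4 * Real.sqrt n := sub_nonneg.2 hT
  have h2 : 0 ≤ T + 5 / 4 * Real.sqrt n := by linarith
  nlinarith [mul_nonneg h1 h2, hsq]

/-- **Every term is non-released above the cut, uniformly**: for `m ≥ 2`, `n ≥ 1`, `(5/4)√n ≤ T ≤ Y`,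
`‖∫_T^Y m^{−w}(2 − k_n(w)) dy‖ ≤ m^{−3/2} (16 + 440 e)` (prover g5's `PrimeTail.norm_integral_termIntegrand_le` with the
gap `g = log 2 − 16/25 > 1/20`, `n/T² ≤ 16/25`, `log m ≥ log 2 > 1/2`). -/
theorem norm_integral_termIntegrand_le_of_cut {n m : ℕ} (hn : 1 ≤ n) (hm : 2 ≤ m) {T Y : ℝ}
    (hT : 5 / 4 * Real.sqrt n ≤ T) (hTY : T ≤ Y) :
    ‖∫ y in T..Y, termIntegrand n m y‖ ≤ (m : ℝ) ^ (-(3 / 2 : ℝ)) * (16 + 440 * Real.exp 1) := by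
  obtain ⟨hT1, _, hTn⟩ := cut_facts hn hT
  have hT0 : 0 < T := by linarith
  have hT2 : 0 < T ^ 2 := by positivity
  have hlogm : Real.log 2 ≤ Real.log m := Real.log_le_log (by norm_num) (by exact_mod_cast hm)
  have hl2 : (1 / 2 : ℝ) ≤ Real.log 2 := by linarith [Real.log_two_gt_d9]
  set L : ℝ := Real.log m with hL
  have hL0 : 0 < L := by linarith
  have hLsq : 1 / 4 ≤ L ^ 2 := by nlinarith
  set g : ℝ := Real.log 2 - 16 / 25 with hgdef
  have hg : 1 / 20 < g := log_two_sub_gt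
  have hg0 : 0 < g := by linarith
  have hgsq : 1 / 400 ≤ g ^ 2 := by nlinarith
  -- the cut ratio `n/T² ≤ 16/25`
  have hr : (n : ℝ) / T ^ 2 ≤ 16 / 25 := by rw [div_le_iff₀ hT2]; linarith
  have hgm : g ≤ Real.log m - n / T ^ 2 := by linarith
  have key := norm_integral_termIntegrand_le (n := n) hm hT1 hTY hg0 hgm
  refine key.trans (mul_le_mul_of_nonneg_left ?_ (by positivity))
  -- the five pieces of the bracket
  have h1 : 6 / L ≤ 12 := by rw [div_le_iff₀ hL0]; linarith
  have h2 : 3 * (n : ℝ) / (2 * T ^ 2 * L ^ 2) ≤ 4 := by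
    rw [div_le_iff₀ (by positivity)]
    nlinarith [mul_le_mul_of_nonneg_left hLsq (sq_nonneg T)]
  have h3 : Real.exp (n / T ^ 2) ≤ Real.exp 1 := Real.exp_le_exp.2 (by linarith)
  have h4 : 2 / g ≤ 40 := by rw [div_le_iff₀ hg0]; linarith
  have h5 : 3 * (n : ℝ) / (2 * T ^ 2 * g ^ 2) ≤ 400 := by
    rw [div_le_iff₀ (by positivity)]
    nlinarith [mul_le_mul_of_nonneg_left hgsq (sq_nonneg T)]
  have h45 : Real.exp (n / T ^ 2) * (2 / g + 3 * (n : ℝ) / (2 * T ^ 2 * g ^ 2)) ≤ Real.exp 1 * 440 :=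
    mul_le_mul h3 (by linarith) (by positivity) (Real.exp_pos 1).le
  linarith

/-! ### The prime integrand on a window, uniformly in the window -/

/-- **Window bound, uniform in `Y`**: for `n ≥ 1` and `(5/4)√n ≤ T ≤ Y`,
`‖∫_T^Y L(Λ, w)(2 − k_n(w)) dy‖ ≤ (Σ_m Λ(m) m^{−3/2}) · (16 + 440 e)` (`L(Λ, w)(2 − k_n(w)) = Σ_m Λ(m)·m^{−w}(2 − k_n(w))`
termwise by dominated convergence, each term by `norm_integral_termIntegrand_le_of_cut`). -/
theorem norm_integral_primeIntegrand_le {n : ℕ} (hn : 1 ≤ n) {T Y : ℝ} (hT : 5 / 4 * Real.sqrt n ≤ T)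
    (hTY : T ≤ Y) :
    ‖∫ y in T..Y, primeIntegrand n y‖ ≤
      (∑' m : ℕ, ‖LSeries.term (fun m ↦ (Λ m : ℂ)) (3 / 2 : ℂ) m‖) * (16 + 440 * Real.exp 1) := by
  obtain ⟨_, hTs, _⟩ := cut_facts hn hT
  set K : ℝ := 16 + 440 * Real.exp 1 with hK
  set f : ℕ → ℂ := fun m ↦ (Λ m : ℂ) with hf
  have hsum := summable_norm_term
  -- the term functions `Λ(m) m^{−w} (2 − k_n(w)) = Λ(m) · termIntegrand n m`
  set F : ℕ → ℝ → ℂ := fun m y ↦ LSeries.term f (liRightPt y) m * liCoSymWeight n (liRightPt y) with hFdef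
  have hF : ∀ m y, F m y = (Λ m : ℂ) * termIntegrand n m y := by
    intro m y
    simp only [hFdef, hf, term_eq, termIntegrand]
    ring
  -- dominated convergence on `[T, Y]`: `HasSum (∫ F m) (∫ L (2 − k_n))`
  have hJ : HasSum (fun m ↦ ∫ y in T..Y, F m y) (∫ y in T..Y, primeIntegrand n y) := by
    refine intervalIntegral.hasSum_integral_of_dominated_convergence
      (fun m _ ↦ ‖LSeries.term f (3 / 2 : ℂ) m‖ * (3 + Real.exp 1)) ?_ ?_ ?_ ?_ ?_
    · intro m; exact ((continuous_term m).mul (continuous_coSymWeight n)).aestronglyMeasurable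
    · intro m
      refine Filter.Eventually.of_forall fun y hy ↦ ?_
      rw [uIoc_of_le hTY] at hy
      have hy' : Real.sqrt n ≤ y := hTs.trans hy.1.le
      simp only [hFdef]
      rw [norm_mul, norm_term_rightPt]
      refine mul_le_mul_of_nonneg_left ?_ (norm_nonneg _)
      rw [liCoSymWeight, liSymWeight_rightPt]
      calc ‖(2 : ℂ) - (zq y ^ n + (zq y ^ n)⁻¹)‖ ≤ ‖(2 : ℂ)‖ + ‖zq y ^ n + (zq y ^ n)⁻¹‖ := norm_sub_le _ _
        _ ≤ 2 + (1 + Real.exp 1) := by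
            rw [Complex.norm_two]
            exact add_le_add le_rfl
              ((norm_add_le _ _).trans (add_le_add (norm_zq_pow_le_one n y) (norm_zq_pow_inv_le n hy')))
        _ = 3 + Real.exp 1 := by ring
    · refine Filter.Eventually.of_forall fun y _ ↦ ?_
      exact hsum.mul_right (3 + Real.exp 1)
    · exact intervalIntegrable_const
    · refine Filter.Eventually.of_forall fun y _ ↦ ?_
      have hre : (1 : ℝ) < (liRightPt y).re := by rw [liRightPt_re]; norm_num
      have hs : LSeriesSummable f (liRightPt y) := ArithmeticFunction.LSeriesSummable_vonMangoldt hre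
      show HasSum (fun m ↦ LSeries.term f (liRightPt y) m * liCoSymWeight n (liRightPt y))
        (LSeries f (liRightPt y) * liCoSymWeight n (liRightPt y))
      exact hs.hasSum.mul_right _
  -- per-term bounds
  have hGb : ∀ m, ‖∫ y in T..Y, F m y‖ ≤ ‖LSeries.term f (3 / 2 : ℂ) m‖ * K := by
    intro m
    have e1 : (∫ y in T..Y, F m y) = ∫ y in T..Y, (Λ m : ℂ) * termIntegrand n m y :=
      intervalIntegral.integral_congr fun y _ ↦ hF m y
    rw [e1, intervalIntegral.integral_const_mul]
    rcases lt_or_ge m 2 with hm | hm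
    · have h0 := vonMangoldt_eq_zero_of_lt_two hm
      simp only [h0, Complex.ofReal_zero, zero_mul, norm_zero]
      positivity
    · have hm0 : 0 < m := by omega
      rw [norm_mul, norm_term_three_halves hm0, Complex.norm_real, Real.norm_eq_abs,
        abs_of_nonneg ArithmeticFunction.vonMangoldt_nonneg, mul_assoc]
      exact mul_le_mul_of_nonneg_left (norm_integral_termIntegrand_le_of_cut hn hm hT hTY)
        ArithmeticFunction.vonMangoldt_nonneg
  calc ‖∫ y in T..Y, primeIntegrand n y‖ = ‖∑' m, ∫ y in T..Y, F m y‖ := by rw [hJ.tsum_eq]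
    _ ≤ ∑' m, ‖LSeries.term f (3 / 2 : ℂ) m‖ * K := tsum_of_norm_bounded (hsum.mul_right K).hasSum hGb
    _ = (∑' m, ‖LSeries.term f (3 / 2 : ℂ) m‖) * K := tsum_mul_right

/-! ### The prime tail -/

/-- **The prime tail is bounded above `(5/4)√n`**: for `n ≥ 1` and `T ≥ (5/4)√n`,
`|liPrimeTail n T| ≤ π^{−1} (Σ_m Λ(m) m^{−3/2}) (16 + 440 e)` (window bound + `Y → ∞` along `T + k`,
`TailContour.tendsto_pieces`). -/
theorem abs_liPrimeTail_le {n : ℕ} (hn : 1 ≤ n) {T : ℝ} (hT : 5 / 4 * Real.sqrt n ≤ T) :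
    |liPrimeTail n T| ≤
      1 / Real.pi * ((∑' m : ℕ, ‖LSeries.term (fun m ↦ (Λ m : ℂ)) (3 / 2 : ℂ) m‖) * (16 + 440 * Real.exp 1)) := by
  obtain ⟨hT1, _, _⟩ := cut_facts hn hT
  have hb : Tendsto (fun k : ℕ ↦ T + k) atTop atTop :=
    tendsto_atTop_add_const_left _ _ tendsto_natCast_atTop_atTop
  have hlim := (tendsto_pieces n hT1 hb).2.2
  refine le_of_tendsto hlim.abs (Filter.Eventually.of_forall fun k ↦ ?_)
  have hTY : T ≤ T + k := le_add_of_nonneg_right (Nat.cast_nonneg k)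
  rw [abs_mul, abs_of_pos (by positivity : (0 : ℝ) < 1 / Real.pi)]
  refine mul_le_mul_of_nonneg_left ?_ (by positivity)
  exact (Complex.abs_re_le_norm _).trans (norm_integral_primeIntegrand_le hn hT hTY)

/-- **BC5 RUNG `stub_rung_silent` of crux K2′ `LiPrimeTailLaguerre` (stmt-RiemannHypothesis-19702), signature verbatim
(`Cruxes.LiPrimeTailLaguerre.Birth.Sig.stub_rung_silent`): the crux in the SILENT regime `c ≥ 5/4` (no released prime
power).**  For `c ≥ 5/4` there are `N`, `C` with `|liPrimeTail n T| ≤ C log n` for all `n ≥ N` and `T ∈ [c√n, c√n + 1]`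
(here `N = 2` and the bound is in fact `O(1)`, `abs_liPrimeTail_le`).  RH-FREE; first-derivative test on `Re w = 3/2`. -/
theorem stub_rung_silent : ∀ c : ℝ, 5 / 4 ≤ c → ∃ N : ℕ, ∃ C : ℝ, ∀ n : ℕ, N ≤ n → ∀ T : ℝ,
    c * Real.sqrt n ≤ T → T ≤ c * Real.sqrt n + 1 → |liPrimeTail n T| ≤ C * Real.log n := by
  intro c hc
  set B : ℝ := 1 / Real.pi *
    ((∑' m : ℕ, ‖LSeries.term (fun m ↦ (Λ m : ℂ)) (3 / 2 : ℂ) m‖) * (16 + 440 * Real.exp 1)) with hB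
  refine ⟨2, B / Real.log 2, fun n hn T hT1 _ ↦ ?_⟩
  have hs0 : 0 ≤ Real.sqrt n := Real.sqrt_nonneg _
  have hT : 5 / 4 * Real.sqrt n ≤ T := (mul_le_mul_of_nonneg_right hc hs0).trans hT1
  have h := abs_liPrimeTail_le (by omega) hT
  have hB0 : 0 ≤ B := (abs_nonneg _).trans h
  have h2 : 0 < Real.log 2 := Real.log_pos (by norm_num)
  have hlog : Real.log 2 ≤ Real.log n := Real.log_le_log (by norm_num) (by exact_mod_cast hn)
  calc |liPrimeTail n T| ≤ B := h
    _ = B / Real.log 2 * Real.log 2 := by field_simp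
    _ ≤ B / Real.log 2 * Real.log n := mul_le_mul_of_nonneg_left hlog (div_nonneg hB0 h2.le)

end RungSilent

end Summit.RiemannHypothesis.RiemannHypothesis.Theorems.LiTheory

end
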